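import Literature.AlgebraicGeometry.PlaneCurves.HessePencilTriangles
import HarnessLib

/-!
# The invariant curves `Φ₆, Φ₉, Φ₁₂, Φ'₁₂, Φ₁₈` of the Hessian group (Artebani–Dolgachev §4)

Topic `Literature/AlgebraicGeometry/PlaneCurves`, namespace `Literature.AlgebraicGeometry.PlaneCurves`.
Lane `lit-hodgefound`, seat `lit-hodgefound-p37`, row g18-#6; a one-file sequel of
`HessePencilTriangles` (g17-#10: `E_{−3} = H₁ = (X + Y + Z)(X + ωY + ω²Z)(X + ω²Y + ωZ)`, the
four triangles) and `HessePencilHessianGroup` (g18-#5: the generators `g₃ = [[1,1,1],[1,ε,ε²],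
[1,ε²,ε]]`, `g₄`, and their action `μ ↦ (μ+2)/(μ−1)`, `μ ↦ ε²μ` on the parameter).  Everything
here is PROVED (polynomial identities); no definition, no named fact.

Source followed — M. Artebani, I. Dolgachev, *The Hesse pencil of plane cubic curves*,
L'Enseignement Math. (2) 55 (2009) 235–273 [arXiv:math/0611590, held `paper:arxiv-math_0611590`
p0008 L58–L74], §4, VERBATIM:

> The Hessian group `G₂₁₆`, considered as a subgroup `PGL(3, ℂ)`, admits two different extensions
> to a subgroup of `GL(3, ℂ)` generated by complex reflections. The first group `Ḡ₂₁₆` is of order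
> `648` and is generated by reflections of order `3` […] The algebra of invariants of `Ḡ₂₁₆` is
> generated by three polynomials of degrees `6`, `9` and `12` (see [Maschke], [Springer])
> `Φ₆ = x⁶ + y⁶ + z⁶ − 10(x³y³ + x³z³ + y³z³)`, `Φ₉ = (x³ − y³)(x³ − z³)(y³ − z³)`,
> `Φ₁₂ = (x³ + y³ + z³)[(x³ + y³ + z³)³ + 216x³y³z³]`.
> Note that the curve `Φ₉ = 0` is the union of the nine harmonic polars `L_i` and the curve
> `Φ₁₂ = 0` is the union of the four equianharmonic members of the pencil. The union of the 12
> inflection lines is obviously invariant with respect to `G₂₁₆`, however the corresponding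
> polynomial `Φ'₁₂` of degree `12` is not an invariant but a relative invariant (i.e. the elements
> of `Ḡ₂₁₆` transform the polynomial to a constant multiple). […]
> `Φ₁₈ = (x³ + y³ + z³)⁶ − 540x³y³z³(x³ + y³ + z³)³ − 5832x⁶y⁶z⁶.`
> The curve `Φ₁₈ = 0` is the union of the six harmonic cubics in the pencil.
> (and, for `G'₂₁₆`) […] it is generated by `g₁, g₂, (1/(ε − ε²)) g₃, e^{2πi/9} g₄` considered as
> linear transformations.

## Dictionary

* `S = X³ + Y³ + Z³`, `P = XYZ`, `H_μ = S − 3μP` (local notation `𝐇[μ]`); `ε = ω` with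
  `ω² + ω + 1 = 0`; the five forms are written out (local notations `Φ₆, Φ₉, Φ₁₂, Φ'₁₂, Φ₁₈`, no
  definitions), with `Φ'₁₂ = XYZ · ∏(the nine lines of the three triangles H₁, H_ω, H_{ω²})
  = P(S³ − 27P³)` (`phi12'_eq_prod`).
* "`F` is invariant under the (scalar-normalised) generator `c⁻¹g`" for a form of degree `d` is
  the identity `F ∘ g = c^d · F` (`F ∘ g = bind₁ g.toMvPolynomial F`); with `c = ε − ε²`,
  `c² = −3` (`omega_sub_omega_sq_sq`), so `c⁶ = −27`, `c⁹ = 81c`, `c¹² = 729`.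
* The equianharmonic members are `μ(μ³ + 8) = 0`, the harmonic ones `μ⁶ − 20μ³ − 8 = 0`, the
  triangles `μ³ = 1` and `XYZ` (`HessePencilHarmonicMembers`, `HessePencilWeierstrassForm`).

## What is here

* §1 **"the curve `Φ₁₂ = 0` is the union of the four equianharmonic members of the pencil"**:
  `phi12_eq_prod` — `Φ₁₂ = H₀ · H_{−2} · H_{−2ω} · H_{−2ω²}` identically, and
  `equianharmonic_parameters` — `μ(μ³ + 8) = μ(μ + 2)(μ + 2ω)(μ + 2ω²)` (the four parameters
  `0, −2, −2ω, −2ω²`); **the twelve inflection lines**: `phi12'_eq_prod` —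
  `P(S³ − 27P³) = XYZ · H₁ · H_ω · H_{ω²}` (the triangles of `HessePencilTriangles`).
* §2 **"The curve `Φ₁₈ = 0` is the union of the six harmonic cubics"** (pointwise, over any field):
  `phi18_eq` (`Φ₁₈ = S⁶ − 20S³(3P)³ − 8(3P)⁶`), `phi18_eval_of_mem` — at a point `q` of `H_m`,
  `Φ₁₈(q) = 729·P(q)⁶·(m⁶ − 20m³ − 8)`, so `Φ₁₈` vanishes on the harmonic members; likewise
  `phi12_eval_of_mem` (`Φ₁₂(q) = 81m(m³ + 8)P(q)⁴`: vanishes on the equianharmonic members) and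
  `phi12'_eval_of_mem` (`Φ'₁₂(q) = 27(m³ − 1)P(q)⁴`: vanishes on the triangles).
* §3 **Invariance under `g₃`** (`ω² + ω + 1 = 0`): `sum_rows_g₃_pow_three`
  (`(x+y+z)³ + (x+εy+ε²z)³ + (x+ε²y+εz)³ = 3S + 18P`), `bind₁_g₃_S`, `bind₁_g₃_P` (`S ∘ g₃ = 3S + 18P`,
  `P ∘ g₃ = S − 3P = H₁`), and **`phi6_bind₁_g₃`** (`Φ₆ ∘ g₃ = −27·Φ₆ = c⁶Φ₆`), **`phi9_bind₁_g₃`**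
  (`Φ₉ ∘ g₃ = 81(ω − ω²)·Φ₉ = c⁹Φ₉`), **`phi12_bind₁_g₃`** (`Φ₁₂ ∘ g₃ = 729·Φ₁₂ = c¹²Φ₁₂`),
  `phi12'_bind₁_g₃` (`Φ'₁₂ ∘ g₃ = 729·Φ'₁₂`); `omega_sub_omega_sq_sq` (`(ω − ω²)² = −3`) and
  `omega_sub_omega_sq_pow` (`c⁶ = −27`, `c⁹ = 81c`, `c¹² = 729`).
* §4 **The reflections `ρ_w = diag(w, 1, 1)`, `w³ = 1`** (e.g. `ω²·g₄`-type generators of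
  `Ḡ₂₁₆`): `phi6_bind₁_refl`, `phi9_bind₁_refl`, `phi12_bind₁_refl` — `Φ₆, Φ₉, Φ₁₂` are invariant
  on the nose —, and **`phi12'_bind₁_refl`** — `Φ'₁₂ ∘ ρ_w = w · Φ'₁₂`: "`Φ'₁₂` … is not an
  invariant but a relative invariant".

NOT here: that `Φ₆, Φ₉, Φ₁₂` GENERATE the invariant ring of `Ḡ₂₁₆` (Maschke), the orders `648`,
`1296`, the invariance under `g₁, g₂` (immediate: they permute / rescale the cubes) and the
18 points `Φ₆ ∩ E` (§6 of the source); "`Φ₉ = 0` is the union of the nine harmonic polars" is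
`HessePencilHarmonicPolars.phi₉_eq_prod_harmonicPolars` (row g18-#3).

## References
* [ArtebaniDolgachev2009] M. Artebani, I. Dolgachev, *The Hesse pencil of plane cubic curves*,
  Enseign. Math. (2) 55 (2009) 235–273, §4 (the invariants `Φ₆, Φ₉, Φ₁₂, Φ'₁₂, Φ₁₈`).
-/

set_option autoImplicit false

open MvPolynomial Matrix

namespace Literature.AlgebraicGeometry.PlaneCurves

universe u

/-- The Hesse cubic `H_μ = X³ + Y³ + Z³ − 3μXYZ` (local notation, no definition). -/
local notation3 "𝐇[" μ "]" =>
  (X 0 ^ 3 + X 1 ^ 3 + X 2 ^ 3 - C (3 * μ) * (X 0 * X 1 * X 2) : MvPolynomial (Fin 3) _)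

/-- `Φ₆ = x⁶ + y⁶ + z⁶ − 10(x³y³ + x³z³ + y³z³)` (local notation, no definition). -/
local notation3 "Φ₆" => (X 0 ^ 6 + X 1 ^ 6 + X 2 ^ 6 -
  10 * (X 0 ^ 3 * X 1 ^ 3 + X 0 ^ 3 * X 2 ^ 3 + X 1 ^ 3 * X 2 ^ 3) : MvPolynomial (Fin 3) _)

/-- `Φ₉ = (x³ − y³)(x³ − z³)(y³ − z³)` (local notation, no definition). -/
local notation3 "Φ₉" =>
  ((X 0 ^ 3 - X 1 ^ 3) * (X 0 ^ 3 - X 2 ^ 3) * (X 1 ^ 3 - X 2 ^ 3) : MvPolynomial (Fin 3) _)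

/-- `Φ₁₂ = (x³ + y³ + z³)[(x³ + y³ + z³)³ + 216x³y³z³]` (local notation, no definition). -/
local notation3 "Φ₁₂" => ((X 0 ^ 3 + X 1 ^ 3 + X 2 ^ 3) *
  ((X 0 ^ 3 + X 1 ^ 3 + X 2 ^ 3) ^ 3 + 216 * (X 0 * X 1 * X 2) ^ 3) : MvPolynomial (Fin 3) _)

/-- `Φ'₁₂ = xyz[(x³ + y³ + z³)³ − 27x³y³z³]`, the product of the twelve inflection lines (local
notation, no definition; see `phi12'_eq_prod`). -/
local notation3 "Φ'₁₂" => ((X 0 * X 1 * X 2) *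
  ((X 0 ^ 3 + X 1 ^ 3 + X 2 ^ 3) ^ 3 - 27 * (X 0 * X 1 * X 2) ^ 3) : MvPolynomial (Fin 3) _)

/-- `Φ₁₈ = (x³ + y³ + z³)⁶ − 540x³y³z³(x³ + y³ + z³)³ − 5832x⁶y⁶z⁶` (local notation, no
definition). -/
local notation3 "Φ₁₈" => ((X 0 ^ 3 + X 1 ^ 3 + X 2 ^ 3) ^ 6 -
  540 * (X 0 * X 1 * X 2) ^ 3 * (X 0 ^ 3 + X 1 ^ 3 + X 2 ^ 3) ^ 3 -
  5832 * (X 0 * X 1 * X 2) ^ 6 : MvPolynomial (Fin 3) _)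

/-- `g₃ = [[1, 1, 1], [1, ε, ε²], [1, ε², ε]]` (local notation, no definition). -/
local notation3 "𝐠₃[" ω "]" =>
  (Matrix.of ![![(1 : _), 1, 1], ![1, ω, ω ^ 2], ![1, ω ^ 2, ω]] : Matrix (Fin 3) (Fin 3) _)

/-- The reflection `ρ_w = diag(w, 1, 1)` (local notation, no definition). -/
local notation3 "𝛒[" w "]" =>
  (Matrix.of ![![w, 0, 0], ![(0 : _), 1, 0], ![0, 0, 1]] : Matrix (Fin 3) (Fin 3) _)

section Invariants

variable {K : Type u} [Field K]

/-- `C ω² + C ω + 1 = 0` in `K[X, Y, Z]`. [folklore] -/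
private theorem C_omega_rel' {ω : K} (hω : ω ^ 2 + ω + 1 = 0) :
    (C ω : MvPolynomial (Fin 3) K) ^ 2 + C ω + 1 = 0 := by
  rw [← C_pow, ← C_add, ← C_1, ← C_add, hω, C_0]

/-- `C w ^ 3 = 1` in `K[X, Y, Z]` for `w³ = 1`. [folklore] -/
private theorem C_pow_three_eq_one' {w : K} (hw : w ^ 3 = 1) :
    (C w : MvPolynomial (Fin 3) K) ^ 3 = 1 := by
  rw [← C_pow, hw, C_1]

/-- The linear forms of a `3 × 3` substitution, written out. [folklore] -/
private theorem toMvPolynomial_fin_three_inv (M : Matrix (Fin 3) (Fin 3) K) (i : Fin 3) :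
    M.toMvPolynomial i = C (M i 0) * X 0 + C (M i 1) * X 1 + C (M i 2) * X 2 := by
  simp only [Matrix.toMvPolynomial, Fin.sum_univ_three, ← C_mul_X_eq_monomial]

/-- The substitution `g₃` on the variables. [cite: ArtebaniDolgachev2009, §4 (the generator `g₃`)] -/
private theorem bind₁_g₃_X (ω : K) :
    bind₁ (𝐠₃[ω] : Matrix (Fin 3) (Fin 3) K).toMvPolynomial (X 0 : MvPolynomial (Fin 3) K) =
        X 0 + X 1 + X 2 ∧
      bind₁ (𝐠₃[ω] : Matrix (Fin 3) (Fin 3) K).toMvPolynomial (X 1 : MvPolynomial (Fin 3) K) =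
        X 0 + C ω * X 1 + C ω ^ 2 * X 2 ∧
      bind₁ (𝐠₃[ω] : Matrix (Fin 3) (Fin 3) K).toMvPolynomial (X 2 : MvPolynomial (Fin 3) K) =
        X 0 + C ω ^ 2 * X 1 + C ω * X 2 := by
  refine ⟨?_, ?_, ?_⟩ <;>
    simp only [bind₁_X_right, toMvPolynomial_fin_three_inv, Matrix.of_apply,
      Matrix.cons_val_zero, Matrix.cons_val_one, Matrix.cons_val_two, Matrix.head_cons,
      Matrix.tail_cons, map_one, one_mul, map_pow]

/-- The substitution `ρ_w` on the variables. [cite: ArtebaniDolgachev2009, §4 (reflections of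
order `3`)] -/
private theorem bind₁_refl_X (w : K) :
    bind₁ (𝛒[w] : Matrix (Fin 3) (Fin 3) K).toMvPolynomial (X 0 : MvPolynomial (Fin 3) K) =
        C w * X 0 ∧
      bind₁ (𝛒[w] : Matrix (Fin 3) (Fin 3) K).toMvPolynomial (X 1 : MvPolynomial (Fin 3) K) = X 1 ∧
      bind₁ (𝛒[w] : Matrix (Fin 3) (Fin 3) K).toMvPolynomial (X 2 : MvPolynomial (Fin 3) K) = X 2 := by
  refine ⟨?_, ?_, ?_⟩ <;>
    simp only [bind₁_X_right, toMvPolynomial_fin_three_inv, Matrix.of_apply,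
      Matrix.cons_val_zero, Matrix.cons_val_one, Matrix.cons_val_two, Matrix.head_cons,
      Matrix.tail_cons, map_one, map_zero, one_mul, zero_mul, add_zero, zero_add]

/-! ## §1 `Φ₁₂` and the four equianharmonic members; `Φ'₁₂` and the twelve inflection lines -/

/-- **"the curve `Φ₁₂ = 0` is the union of the four equianharmonic members of the pencil"**:
`Φ₁₂ = H₀ · H_{−2} · H_{−2ω} · H_{−2ω²}` identically in `K[X, Y, Z]` (`ω² + ω + 1 = 0`; the
equianharmonic parameters are `0, −2, −2ω, −2ω²`, `equianharmonic_parameters`).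
[cite: ArtebaniDolgachev2009, §4 (the invariant `Φ₁₂`)] -/
theorem phi12_eq_prod {ω : K} (hω : ω ^ 2 + ω + 1 = 0) :
    (Φ₁₂ : MvPolynomial (Fin 3) K) = 𝐇[(0 : K)] * (𝐇[(-2 : K)] * 𝐇[-2 * ω] * 𝐇[-2 * ω ^ 2]) := by
  have hr := C_omega_rel' hω
  simp only [mul_zero, C_0, zero_mul, sub_zero, map_mul, map_neg, map_pow, map_ofNat]
  linear_combination (-((X 0 ^ 3 + X 1 ^ 3 + X 2 ^ 3 : MvPolynomial (Fin 3) K) *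
    (((X 0 ^ 3 + X 1 ^ 3 + X 2 ^ 3) + 6 * (X 0 * X 1 * X 2)) *
      ((X 0 ^ 3 + X 1 ^ 3 + X 2 ^ 3) * (6 * (X 0 * X 1 * X 2)) +
        (6 * (X 0 * X 1 * X 2)) ^ 2 * (C ω - 1))))) * hr

/-- The four equianharmonic parameters: `μ(μ³ + 8) = μ(μ + 2)(μ + 2ω)(μ + 2ω²)` for
`ω² + ω + 1 = 0` (the zeroes of `A`: `μ ∈ {0, −2, −2ω, −2ω²}`, i.e. `λ = −3μ ∈ {0, 6, 6ε, 6ε²}`).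
[cite: ArtebaniDolgachev2009, §2 (the binary form `A`), §4 (`Φ₁₂`)] -/
theorem equianharmonic_parameters {ω : K} (hω : ω ^ 2 + ω + 1 = 0) (μ : K) :
    μ * (μ ^ 3 + 8) = μ * (μ + 2) * (μ + 2 * ω) * (μ + 2 * ω ^ 2) := by
  linear_combination (-(μ * (μ + 2) * (μ * 2 + 4 * (ω - 1)))) * hω

/-- **The twelve inflection lines**: `Φ'₁₂ = XYZ · H₁ · H_ω · H_{ω²}` identically (`ω² + ω + 1 = 0`)
— `XYZ = E_∞` and the three triangles `E_{−3}, E_{−3ε}, E_{−3ε²}` of `HessePencilTriangles`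
(`hesse_one_eq_prod`, `hesse_omega_eq_prod`, `hesse_omega_sq_eq_prod` split them into the
twelve lines). [cite: ArtebaniDolgachev2009, §4 ("The union of the 12 inflection lines … the
corresponding polynomial `Φ'₁₂` of degree 12")] -/
theorem phi12'_eq_prod {ω : K} (hω : ω ^ 2 + ω + 1 = 0) :
    (Φ'₁₂ : MvPolynomial (Fin 3) K) = (X 0 * X 1 * X 2) * (𝐇[(1 : K)] * 𝐇[ω] * 𝐇[ω ^ 2]) := by
  have hr := C_omega_rel' hω
  simp only [mul_one, map_mul, map_pow, map_ofNat]
  linear_combination ((X 0 * X 1 * X 2 : MvPolynomial (Fin 3) K) *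
    (((X 0 ^ 3 + X 1 ^ 3 + X 2 ^ 3) - 3 * (X 0 * X 1 * X 2)) *
      ((X 0 ^ 3 + X 1 ^ 3 + X 2 ^ 3) * (3 * (X 0 * X 1 * X 2)) -
        (C ω - 1) * (3 * (X 0 * X 1 * X 2)) ^ 2))) * hr

/-! ## §2 `Φ₁₈`, `Φ₁₂`, `Φ'₁₂` on the members of the pencil -/

/-- `Φ₁₈ = S⁶ − 20S³(3P)³ − 8(3P)⁶` with `S = X³ + Y³ + Z³`, `P = XYZ`: the harmonic sextic
`m⁶ − 20m³ − 8` of `HessePencilHarmonicMembers` made homogeneous in `(S, 3P)`.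
[cite: ArtebaniDolgachev2009, §4 (the invariant `Φ₁₈`), §2 (the binary form `B`)] -/
theorem phi18_eq :
    (Φ₁₈ : MvPolynomial (Fin 3) K) = (X 0 ^ 3 + X 1 ^ 3 + X 2 ^ 3) ^ 6 -
      20 * (X 0 ^ 3 + X 1 ^ 3 + X 2 ^ 3) ^ 3 * (3 * (X 0 * X 1 * X 2)) ^ 3 -
      8 * (3 * (X 0 * X 1 * X 2)) ^ 6 := by
  ring

/-- **"The curve `Φ₁₈ = 0` is the union of the six harmonic cubics in the pencil"** (pointwise,
over any field): at a point `q` of the member `H_m`, `Φ₁₈(q) = 729·(q₀q₁q₂)⁶·(m⁶ − 20m³ − 8)` — so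
`Φ₁₈` vanishes identically on the six harmonic members `m⁶ − 20m³ − 8 = 0`, and on another
member exactly at its points with `q₀q₁q₂ = 0` (when `3 ≠ 0`). [cite: ArtebaniDolgachev2009, §4
(the invariant `Φ₁₈`)] -/
theorem phi18_eval_of_mem (m : K) {q : Fin 3 → K} (hq : eval q 𝐇[m] = 0) :
    eval q (Φ₁₈ : MvPolynomial (Fin 3) K) =
      729 * (q 0 * q 1 * q 2) ^ 6 * (m ^ 6 - 20 * m ^ 3 - 8) := by
  rw [hesse_eval] at hq
  simp only [map_sub, map_mul, map_pow, map_add, eval_X, map_ofNat]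
  linear_combination ((q 0 ^ 3 + q 1 ^ 3 + q 2 ^ 3) ^ 5 +
      3 * (q 0 ^ 3 + q 1 ^ 3 + q 2 ^ 3) ^ 4 * (q 0 * q 1 * q 2) * m +
      9 * (q 0 ^ 3 + q 1 ^ 3 + q 2 ^ 3) ^ 3 * (q 0 * q 1 * q 2) ^ 2 * m ^ 2 +
      27 * (q 0 ^ 3 + q 1 ^ 3 + q 2 ^ 3) ^ 2 * (q 0 * q 1 * q 2) ^ 3 * m ^ 3 -
      540 * (q 0 ^ 3 + q 1 ^ 3 + q 2 ^ 3) ^ 2 * (q 0 * q 1 * q 2) ^ 3 +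
      81 * (q 0 ^ 3 + q 1 ^ 3 + q 2 ^ 3) * (q 0 * q 1 * q 2) ^ 4 * m ^ 4 -
      1620 * (q 0 ^ 3 + q 1 ^ 3 + q 2 ^ 3) * (q 0 * q 1 * q 2) ^ 4 * m +
      243 * (q 0 * q 1 * q 2) ^ 5 * m ^ 5 - 4860 * (q 0 * q 1 * q 2) ^ 5 * m ^ 2) * hq

/-- On the member `H_m`, `Φ₁₂(q) = 81·m(m³ + 8)·(q₀q₁q₂)⁴`: `Φ₁₂` vanishes identically exactly on
the four equianharmonic members `m(m³ + 8) = 0`. [cite: ArtebaniDolgachev2009, §4 ("the curve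
`Φ₁₂ = 0` is the union of the four equianharmonic members")] -/
theorem phi12_eval_of_mem (m : K) {q : Fin 3 → K} (hq : eval q 𝐇[m] = 0) :
    eval q (Φ₁₂ : MvPolynomial (Fin 3) K) = 81 * (m * (m ^ 3 + 8)) * (q 0 * q 1 * q 2) ^ 4 := by
  rw [hesse_eval] at hq
  simp only [map_mul, map_pow, map_add, eval_X, map_ofNat]
  linear_combination ((q 0 ^ 3 + q 1 ^ 3 + q 2 ^ 3) ^ 3 +
      3 * (q 0 ^ 3 + q 1 ^ 3 + q 2 ^ 3) ^ 2 * (q 0 * q 1 * q 2) * m +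
      9 * (q 0 ^ 3 + q 1 ^ 3 + q 2 ^ 3) * (q 0 * q 1 * q 2) ^ 2 * m ^ 2 +
      27 * (q 0 * q 1 * q 2) ^ 3 * m ^ 3 + 216 * (q 0 * q 1 * q 2) ^ 3) * hq

/-- On the member `H_m`, `Φ'₁₂(q) = 27(m³ − 1)(q₀q₁q₂)⁴`: `Φ'₁₂` vanishes identically exactly on the
triangles `m³ = 1` (and on `XYZ`). [cite: ArtebaniDolgachev2009, §4 (the twelve inflection lines)] -/
theorem phi12'_eval_of_mem (m : K) {q : Fin 3 → K} (hq : eval q 𝐇[m] = 0) :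
    eval q (Φ'₁₂ : MvPolynomial (Fin 3) K) = 27 * (m ^ 3 - 1) * (q 0 * q 1 * q 2) ^ 4 := by
  rw [hesse_eval] at hq
  simp only [map_sub, map_mul, map_pow, map_add, eval_X, map_ofNat]
  linear_combination ((q 0 ^ 3 + q 1 ^ 3 + q 2 ^ 3) ^ 2 * (q 0 * q 1 * q 2) +
      3 * (q 0 ^ 3 + q 1 ^ 3 + q 2 ^ 3) * (q 0 * q 1 * q 2) ^ 2 * m +
      9 * (q 0 * q 1 * q 2) ^ 3 * m ^ 2) * hq

/-! ## §3 Invariance under `g₃` -/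

/-- `(u + v + t)³ + (u + εv + ε²t)³ + (u + ε²v + εt)³ = 3(u³ + v³ + t³) + 18uvt` for any
`u, v, t` (`ω² + ω + 1 = 0`). [cite: ArtebaniDolgachev2009, §4 (the generator `g₃`)] -/
theorem sum_g₃_pow_three {ω : K} (hω : ω ^ 2 + ω + 1 = 0) (u v t : MvPolynomial (Fin 3) K) :
    (u + v + t) ^ 3 + (u + C ω * v + C ω ^ 2 * t) ^ 3 + (u + C ω ^ 2 * v + C ω * t) ^ 3 =
      3 * (u ^ 3 + v ^ 3 + t ^ 3) + 18 * (u * v * t) := by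
  linear_combination (3 * u ^ 2 * v + 3 * u ^ 2 * t + 3 * u * v ^ 2 * C ω ^ 2 - 3 * u * v ^ 2 * C ω + 3 * u * v
      ^ 2 + 12 * u * v * t * C ω - 12 * u * v * t + 3 * u * t ^ 2 * C ω ^ 2 - 3 * u * t ^ 2 * C
      ω + 3 * u * t ^ 2 + v ^ 3 * C ω ^ 4 - v ^ 3 * C ω ^ 3 + 2 * v ^ 3 * C ω - 2 * v ^ 3 + 3 *
      v ^ 2 * t * C ω ^ 3 - 3 * v ^ 2 * t * C ω + 3 * v ^ 2 * t + 3 * v * t ^ 2 * C ω ^ 3 - 3 *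
      v * t ^ 2 * C ω + 3 * v * t ^ 2 + t ^ 3 * C ω ^ 4 - t ^ 3 * C ω ^ 3 + 2 * t ^ 3 * C ω - 2
      * t ^ 3) * C_omega_rel' hω

/-- `(x + y + z)³ + (x + εy + ε²z)³ + (x + ε²y + εz)³ = 3(x³ + y³ + z³) + 18xyz`
(`ω² + ω + 1 = 0`). [cite: ArtebaniDolgachev2009, §4 (the generator `g₃`)] -/
theorem sum_rows_g₃_pow_three {ω : K} (hω : ω ^ 2 + ω + 1 = 0) :
    ((X 0 + X 1 + X 2) ^ 3 + (X 0 + C ω * X 1 + C ω ^ 2 * X 2) ^ 3 +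
        (X 0 + C ω ^ 2 * X 1 + C ω * X 2) ^ 3 : MvPolynomial (Fin 3) K) =
      3 * (X 0 ^ 3 + X 1 ^ 3 + X 2 ^ 3) + 18 * (X 0 * X 1 * X 2) :=
  sum_g₃_pow_three hω (X 0) (X 1) (X 2)

/-- **`S ∘ g₃ = 3S + 18P`** (`S = X³ + Y³ + Z³`, `P = XYZ`). [cite: ArtebaniDolgachev2009, §4] -/
theorem bind₁_g₃_S {ω : K} (hω : ω ^ 2 + ω + 1 = 0) :
    bind₁ (𝐠₃[ω] : Matrix (Fin 3) (Fin 3) K).toMvPolynomial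
        (X 0 ^ 3 + X 1 ^ 3 + X 2 ^ 3 : MvPolynomial (Fin 3) K) =
      3 * (X 0 ^ 3 + X 1 ^ 3 + X 2 ^ 3) + 18 * (X 0 * X 1 * X 2) := by
  obtain ⟨h0, h1, h2⟩ := bind₁_g₃_X ω
  rw [map_add, map_add, map_pow, map_pow, map_pow, h0, h1, h2]
  exact sum_rows_g₃_pow_three hω

/-- **`P ∘ g₃ = S − 3P = H₁`** (the triangle `E_{−3}`: `HessePencilTriangles.hesse_one_eq_prod`).
[cite: ArtebaniDolgachev2009, §4, §2 (`E_{−3}`)] -/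
theorem bind₁_g₃_P {ω : K} (hω : ω ^ 2 + ω + 1 = 0) :
    bind₁ (𝐠₃[ω] : Matrix (Fin 3) (Fin 3) K).toMvPolynomial (X 0 * X 1 * X 2 : MvPolynomial (Fin 3) K) =
      X 0 ^ 3 + X 1 ^ 3 + X 2 ^ 3 - 3 * (X 0 * X 1 * X 2) := by
  obtain ⟨h0, h1, h2⟩ := bind₁_g₃_X ω
  rw [map_mul, map_mul, h0, h1, h2, ← hesse_one_eq_prod hω]
  simp only [mul_one, map_ofNat]

/-- `(ω − ω²)² = −3`: the square of `c = ε − ε²`. [cite: ArtebaniDolgachev2009, §4 (the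
normalisation `(1/(ε − ε²)) g₃`)] -/
theorem omega_sub_omega_sq_sq {ω : K} (hω : ω ^ 2 + ω + 1 = 0) : (ω - ω ^ 2) ^ 2 = -3 := by
  linear_combination (ω ^ 2 - 3 * ω + 3) * hω

/-- `c⁶ = −27`, `c⁹ = 81c`, `c¹² = 729` for `c = ω − ω²`. [cite: ArtebaniDolgachev2009, §4] -/
theorem omega_sub_omega_sq_pow {ω : K} (hω : ω ^ 2 + ω + 1 = 0) :
    (ω - ω ^ 2) ^ 6 = -27 ∧ (ω - ω ^ 2) ^ 9 = 81 * (ω - ω ^ 2) ∧ (ω - ω ^ 2) ^ 12 = 729 := by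
  refine ⟨?_, ?_, ?_⟩
  · linear_combination (ω ^ 10 - 7 * ω ^ 9 + 21 * ω ^ 8 - 34 * ω ^ 7 + 28 * ω ^ 6 - 27 * ω ^ 4 +
      27 * ω ^ 3 - 27 * ω + 27) * hω
  · linear_combination (-ω ^ 16 + 10 * ω ^ 15 - 45 * ω ^ 14 + 119 * ω ^ 13 - 200 * ω ^ 12 +
      207 * ω ^ 11 - 91 * ω ^ 10 - 80 * ω ^ 9 + 162 * ω ^ 8 - 81 * ω ^ 7 - 81 * ω ^ 6 +
      162 * ω ^ 5 - 81 * ω ^ 4 - 81 * ω ^ 3 + 162 * ω ^ 2 - 81 * ω) * hω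
  · linear_combination (ω ^ 22 - 13 * ω ^ 21 + 78 * ω ^ 20 - 285 * ω ^ 19 + 702 * ω ^ 18 -
      1209 * ω ^ 17 + 1431 * ω ^ 16 - 1014 * ω ^ 15 + 78 * ω ^ 14 + 716 * ω ^ 13 - 728 * ω ^ 12 +
      729 * ω ^ 10 - 729 * ω ^ 9 + 729 * ω ^ 7 - 729 * ω ^ 6 + 729 * ω ^ 4 - 729 * ω ^ 3 +
      729 * ω - 729) * hω

/-- **`Φ₆ ∘ g₃ = −27 · Φ₆ = c⁶Φ₆`**: `Φ₆` is invariant under the normalised generator `c⁻¹g₃`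
(`ω² + ω + 1 = 0`).  Proof: with the rows `rᵢ` of `g₃`, `Σrᵢ³ = 3S + 18P` and
`rᵢrⱼ = A + ω^•B + ω^•C` where `A = X² − YZ`, `B = Y² − XZ`, `C = Z² − XY`, so that
`Σ(rᵢrⱼ)³ = 3(A³ + B³ + C³) + 18ABC` by the same cube identity; the rest is an identity free of `ω`.
[cite: ArtebaniDolgachev2009, §4 ("The algebra of invariants of `Ḡ₂₁₆` is generated by …
`Φ₆`, …")] -/
theorem phi6_bind₁_g₃ {ω : K} (hω : ω ^ 2 + ω + 1 = 0) :
    bind₁ (𝐠₃[ω] : Matrix (Fin 3) (Fin 3) K).toMvPolynomial (Φ₆ : MvPolynomial (Fin 3) K) =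
      (-27 : K) • (Φ₆ : MvPolynomial (Fin 3) K) := by
  obtain ⟨h0, h1, h2⟩ := bind₁_g₃_X ω
  have hr := C_omega_rel' hω
  have e1 := sum_rows_g₃_pow_three hω
  have p01 : ((X 0 + X 1 + X 2) * (X 0 + C ω * X 1 + C ω ^ 2 * X 2) : MvPolynomial (Fin 3) K) =
      (X 0 ^ 2 - X 1 * X 2) + C ω * (X 1 ^ 2 - X 0 * X 2) + C ω ^ 2 * (X 2 ^ 2 - X 0 * X 1) := by
    linear_combination (X 0 * X 1 + X 0 * X 2 + X 1 * X 2 : MvPolynomial (Fin 3) K) * hr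
  have p02 : ((X 0 + X 1 + X 2) * (X 0 + C ω ^ 2 * X 1 + C ω * X 2) : MvPolynomial (Fin 3) K) =
      (X 0 ^ 2 - X 1 * X 2) + C ω ^ 2 * (X 1 ^ 2 - X 0 * X 2) + C ω * (X 2 ^ 2 - X 0 * X 1) := by
    linear_combination (X 0 * X 1 + X 0 * X 2 + X 1 * X 2 : MvPolynomial (Fin 3) K) * hr
  have p12 : ((X 0 + C ω * X 1 + C ω ^ 2 * X 2) * (X 0 + C ω ^ 2 * X 1 + C ω * X 2) :
      MvPolynomial (Fin 3) K) =
      (X 0 ^ 2 - X 1 * X 2) + (X 1 ^ 2 - X 0 * X 2) + (X 2 ^ 2 - X 0 * X 1) := by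
    linear_combination (X 0 * X 1 + X 0 * X 2 + X 1 ^ 2 * C ω - X 1 ^ 2 + X 1 * X 2 * C ω ^ 2 -
      X 1 * X 2 * C ω + X 1 * X 2 + X 2 ^ 2 * C ω - X 2 ^ 2 : MvPolynomial (Fin 3) K) * hr
  have k3 := sum_g₃_pow_three hω (X 0 ^ 2 - X 1 * X 2) (X 1 ^ 2 - X 0 * X 2) (X 2 ^ 2 - X 0 * X 1)
  simp only [map_sub, map_add, map_mul, map_pow, map_ofNat, h0, h1, h2, smul_eq_C_mul, map_neg]
  generalize (X 0 + X 1 + X 2 : MvPolynomial (Fin 3) K) = r₀ at e1 p01 p02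
  generalize (X 0 + C ω * X 1 + C ω ^ 2 * X 2 : MvPolynomial (Fin 3) K) = r₁ at e1 p01 p12
  generalize (X 0 + C ω ^ 2 * X 1 + C ω * X 2 : MvPolynomial (Fin 3) K) = r₂ at e1 p02 p12
  linear_combination (r₀ ^ 3 + r₁ ^ 3 + r₂ ^ 3 +
      (3 * (X 0 ^ 3 + X 1 ^ 3 + X 2 ^ 3) + 18 * (X 0 * X 1 * X 2))) * e1 -
    12 * ((r₀ * r₁) ^ 2 + (r₀ * r₁) * ((X 0 ^ 2 - X 1 * X 2) + C ω * (X 1 ^ 2 - X 0 * X 2) +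
      C ω ^ 2 * (X 2 ^ 2 - X 0 * X 1)) + ((X 0 ^ 2 - X 1 * X 2) + C ω * (X 1 ^ 2 - X 0 * X 2) +
      C ω ^ 2 * (X 2 ^ 2 - X 0 * X 1)) ^ 2) * p01 -
    12 * ((r₀ * r₂) ^ 2 + (r₀ * r₂) * ((X 0 ^ 2 - X 1 * X 2) + C ω ^ 2 * (X 1 ^ 2 - X 0 * X 2) +
      C ω * (X 2 ^ 2 - X 0 * X 1)) + ((X 0 ^ 2 - X 1 * X 2) + C ω ^ 2 * (X 1 ^ 2 - X 0 * X 2) +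
      C ω * (X 2 ^ 2 - X 0 * X 1)) ^ 2) * p02 -
    12 * ((r₁ * r₂) ^ 2 + (r₁ * r₂) * ((X 0 ^ 2 - X 1 * X 2) + (X 1 ^ 2 - X 0 * X 2) +
      (X 2 ^ 2 - X 0 * X 1)) + ((X 0 ^ 2 - X 1 * X 2) + (X 1 ^ 2 - X 0 * X 2) +
      (X 2 ^ 2 - X 0 * X 1)) ^ 2) * p12 -
    12 * k3

set_option maxHeartbeats 400000 in
/-- **`Φ₉ ∘ g₃ = 81(ω − ω²) · Φ₉ = c⁹Φ₉`**: `Φ₉` is invariant under `c⁻¹g₃` (`ω² + ω + 1 = 0`).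
Proof: `g₃` permutes the nine harmonic polars up to scalars — the three differences of cubes of
the rows of `g₃` factor as `(3 − 3ω)(X − ω²Y)(X − ωZ)(Y − ω²Z)`,
`(6 + 3ω)(X − ωY)(X − ω²Z)(Y − ωZ)`, `(3 + 6ω)(X − Y)(X − Z)(Y − Z)`, and
`(3 − 3ω)(6 + 3ω)(3 + 6ω) = 81(ω − ω²)`. [cite: ArtebaniDolgachev2009, §4 ("The algebra of
invariants of `Ḡ₂₁₆` is generated by … `Φ₉` …"; "`Φ₉ = 0` is the union of the nine harmonic
polars")] -/
theorem phi9_bind₁_g₃ {ω : K} (hω : ω ^ 2 + ω + 1 = 0) :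
    bind₁ (𝐠₃[ω] : Matrix (Fin 3) (Fin 3) K).toMvPolynomial (Φ₉ : MvPolynomial (Fin 3) K) =
      (81 * (ω - ω ^ 2)) • (Φ₉ : MvPolynomial (Fin 3) K) := by
  obtain ⟨h0, h1, h2⟩ := bind₁_g₃_X ω
  have hr := C_omega_rel' hω
  have d01 : ((X 0 + X 1 + X 2) ^ 3 - (X 0 + C ω * X 1 + C ω ^ 2 * X 2) ^ 3 :
      MvPolynomial (Fin 3) K) =
      (3 - 3 * C ω) * ((X 0 - C ω ^ 2 * X 1) * (X 0 - C ω * X 2) * (X 1 - C ω ^ 2 * X 2)) := by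
    linear_combination (-3 * X 0 ^ 2 * X 2 * C ω + 3 * X 0 ^ 2 * X 2 - 3 * X 0 * X 1 ^ 2 * C ω + 3 * X 0 * X 1 ^ 2
      + 3 * X 0 * X 1 * X 2 * C ω ^ 3 - 6 * X 0 * X 1 * X 2 * C ω ^ 2 - 3 * X 0 * X 1 * X 2 * C
      ω + 6 * X 0 * X 1 * X 2 - 3 * X 0 * X 2 ^ 2 * C ω + 3 * X 0 * X 2 ^ 2 - X 1 ^ 3 * C ω + X
      1 ^ 3 - 3 * X 1 ^ 2 * X 2 * C ω + 3 * X 1 ^ 2 * X 2 - 3 * X 1 * X 2 ^ 2 * C ω ^ 4 + 3 * X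
      1 * X 2 ^ 2 * C ω ^ 3 - 3 * X 1 * X 2 ^ 2 * C ω + 3 * X 1 * X 2 ^ 2 - X 2 ^ 3 * C ω ^ 4 +
      X 2 ^ 3 * C ω ^ 3 - X 2 ^ 3 * C ω + X 2 ^ 3 : MvPolynomial (Fin 3) K) * hr
  have d02 : ((X 0 + X 1 + X 2) ^ 3 - (X 0 + C ω ^ 2 * X 1 + C ω * X 2) ^ 3 :
      MvPolynomial (Fin 3) K) =
      (6 + 3 * C ω) * ((X 0 - C ω * X 1) * (X 0 - C ω ^ 2 * X 2) * (X 1 - C ω * X 2)) := by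
    linear_combination (-3 * X 0 ^ 2 * X 1 + 3 * X 0 ^ 2 * X 2 - 3 * X 0 * X 1 ^ 2 * C ω ^ 2 + 3 * X 0 * X 1 ^ 2 *
      C ω + 3 * X 0 * X 1 ^ 2 - 6 * X 0 * X 1 * X 2 * C ω + 6 * X 0 * X 1 * X 2 - 3 * X 0 * X 2
      ^ 2 * C ω ^ 2 - 3 * X 0 * X 2 ^ 2 * C ω + 3 * X 0 * X 2 ^ 2 - X 1 ^ 3 * C ω ^ 4 + X 1 ^ 3
      * C ω ^ 3 - X 1 ^ 3 * C ω + X 1 ^ 3 - 3 * X 1 ^ 2 * X 2 * C ω ^ 3 - 3 * X 1 ^ 2 * X 2 * C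
      ω + 3 * X 1 ^ 2 * X 2 + 3 * X 1 * X 2 ^ 2 * C ω ^ 3 - 3 * X 1 * X 2 ^ 2 * C ω + 3 * X 1 *
      X 2 ^ 2 - X 2 ^ 3 * C ω + X 2 ^ 3 : MvPolynomial (Fin 3) K) * hr
  have d12 : ((X 0 + C ω * X 1 + C ω ^ 2 * X 2) ^ 3 - (X 0 + C ω ^ 2 * X 1 + C ω * X 2) ^ 3 :
      MvPolynomial (Fin 3) K) =
      (3 + 6 * C ω) * ((X 0 - X 1) * (X 0 - X 2) * (X 1 - X 2)) := by
    linear_combination (-3 * X 0 ^ 2 * X 1 + 3 * X 0 ^ 2 * X 2 - 3 * X 0 * X 1 ^ 2 * C ω ^ 2 + 3 * X 0 * X 1 ^ 2 *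
      C ω + 3 * X 0 * X 1 ^ 2 + 3 * X 0 * X 2 ^ 2 * C ω ^ 2 - 3 * X 0 * X 2 ^ 2 * C ω - 3 * X 0
      * X 2 ^ 2 - X 1 ^ 3 * C ω ^ 4 + X 1 ^ 3 * C ω ^ 3 - 3 * X 1 ^ 2 * X 2 * C ω ^ 3 + 6 * X 1
      ^ 2 * X 2 * C ω ^ 2 - 3 * X 1 ^ 2 * X 2 * C ω - 3 * X 1 ^ 2 * X 2 + 3 * X 1 * X 2 ^ 2 * C
      ω ^ 3 - 6 * X 1 * X 2 ^ 2 * C ω ^ 2 + 3 * X 1 * X 2 ^ 2 * C ω + 3 * X 1 * X 2 ^ 2 + X 2 ^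
      3 * C ω ^ 4 - X 2 ^ 3 * C ω ^ 3 : MvPolynomial (Fin 3) K) * hr
  have key : ∀ u v : MvPolynomial (Fin 3) K,
      u ^ 3 - v ^ 3 = (u - v) * (u - C ω * v) * (u - C ω ^ 2 * v) := fun u v => by
    linear_combination ((u - v) * (u * v - (C ω - 1) * v ^ 2)) * hr
  have hc : (C (81 * (ω - ω ^ 2)) : MvPolynomial (Fin 3) K) =
      (3 - 3 * C ω) * (6 + 3 * C ω) * (3 + 6 * C ω) := by
    simp only [map_mul, map_sub, map_pow, map_ofNat]
    linear_combination (54 * C ω - 54 : MvPolynomial (Fin 3) K) * hr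
  rw [smul_eq_C_mul, hc]
  simp only [map_sub, map_mul, map_pow, h0, h1, h2]
  rw [d01, d02, d12, key (X 0) (X 1), key (X 0) (X 2), key (X 1) (X 2)]
  generalize (X 0 - X 1 : MvPolynomial (Fin 3) K) = l₁
  generalize (X 0 - C ω * X 1 : MvPolynomial (Fin 3) K) = l₂
  generalize (X 0 - C ω ^ 2 * X 1 : MvPolynomial (Fin 3) K) = l₃
  generalize (X 0 - X 2 : MvPolynomial (Fin 3) K) = l₄
  generalize (X 0 - C ω * X 2 : MvPolynomial (Fin 3) K) = l₅
  generalize (X 0 - C ω ^ 2 * X 2 : MvPolynomial (Fin 3) K) = l₆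
  generalize (X 1 - X 2 : MvPolynomial (Fin 3) K) = l₇
  generalize (X 1 - C ω * X 2 : MvPolynomial (Fin 3) K) = l₈
  generalize (X 1 - C ω ^ 2 * X 2 : MvPolynomial (Fin 3) K) = l₉
  ring

/-- **`Φ₁₂ ∘ g₃ = 729 · Φ₁₂ = c¹²Φ₁₂`** (from `S ∘ g₃ = 3(S + 6P)`, `P ∘ g₃ = S − 3P` and
`(S + 6P)³ + 8(S − 3P)³ = 9S(S² − 6SP + 36P²)`). [cite: ArtebaniDolgachev2009, §4 ("The algebra
of invariants of `Ḡ₂₁₆` is generated by … `Φ₁₂`")] -/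
theorem phi12_bind₁_g₃ {ω : K} (hω : ω ^ 2 + ω + 1 = 0) :
    bind₁ (𝐠₃[ω] : Matrix (Fin 3) (Fin 3) K).toMvPolynomial (Φ₁₂ : MvPolynomial (Fin 3) K) =
      (729 : K) • (Φ₁₂ : MvPolynomial (Fin 3) K) := by
  obtain ⟨h0, h1, h2⟩ := bind₁_g₃_X ω
  simp only [map_mul, map_add, map_pow, map_ofNat, h0, h1, h2, smul_eq_C_mul]
  rw [sum_rows_g₃_pow_three hω, ← hesse_one_eq_prod hω]
  simp only [mul_one, map_ofNat]
  ring

/-- `Φ'₁₂ ∘ g₃ = 729 · Φ'₁₂` (the union of the twelve inflection lines is `g₃`-stable; from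
`(S + 6P)³ − (S − 3P)³ = 27P(S² + 3SP + 9P²)`). [cite: ArtebaniDolgachev2009, §4 ("The union
of the 12 inflection lines is obviously invariant with respect to `G₂₁₆`")] -/
theorem phi12'_bind₁_g₃ {ω : K} (hω : ω ^ 2 + ω + 1 = 0) :
    bind₁ (𝐠₃[ω] : Matrix (Fin 3) (Fin 3) K).toMvPolynomial (Φ'₁₂ : MvPolynomial (Fin 3) K) =
      (729 : K) • (Φ'₁₂ : MvPolynomial (Fin 3) K) := by
  obtain ⟨h0, h1, h2⟩ := bind₁_g₃_X ω
  simp only [map_mul, map_sub, map_add, map_pow, map_ofNat, h0, h1, h2, smul_eq_C_mul]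
  rw [sum_rows_g₃_pow_three hω, ← hesse_one_eq_prod hω]
  simp only [mul_one, map_ofNat]
  ring

/-! ## §4 The reflections `ρ_w = diag(w, 1, 1)`: `Φ'₁₂` is only a relative invariant -/

/-- `Φ₆ ∘ ρ_w = Φ₆` for `w³ = 1`. [cite: ArtebaniDolgachev2009, §4 (`Φ₆` an invariant of the
reflection group `Ḡ₂₁₆`)] -/
theorem phi6_bind₁_refl {w : K} (hw : w ^ 3 = 1) :
    bind₁ (𝛒[w] : Matrix (Fin 3) (Fin 3) K).toMvPolynomial (Φ₆ : MvPolynomial (Fin 3) K) = Φ₆ := by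
  obtain ⟨h0, h1, h2⟩ := bind₁_refl_X w
  simp only [map_sub, map_add, map_mul, map_pow, map_ofNat, h0, h1, h2]
  linear_combination ((C w ^ 3 + 1) * X 0 ^ 6 - 10 * (X 0 ^ 3 * X 1 ^ 3 + X 0 ^ 3 * X 2 ^ 3) :
    MvPolynomial (Fin 3) K) * C_pow_three_eq_one' hw

/-- `Φ₉ ∘ ρ_w = Φ₉` for `w³ = 1`. [cite: ArtebaniDolgachev2009, §4 (`Φ₉` an invariant of the
reflection group `Ḡ₂₁₆`)] -/
theorem phi9_bind₁_refl {w : K} (hw : w ^ 3 = 1) :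
    bind₁ (𝛒[w] : Matrix (Fin 3) (Fin 3) K).toMvPolynomial (Φ₉ : MvPolynomial (Fin 3) K) = Φ₉ := by
  obtain ⟨h0, h1, h2⟩ := bind₁_refl_X w
  simp only [map_sub, map_mul, map_pow, h0, h1, h2]
  linear_combination ((X 0 ^ 3 * ((C w ^ 3 + 1) * X 0 ^ 3 - X 1 ^ 3 - X 2 ^ 3)) *
    (X 1 ^ 3 - X 2 ^ 3) : MvPolynomial (Fin 3) K) * C_pow_three_eq_one' hw

/-- `Φ₁₂ ∘ ρ_w = Φ₁₂` for `w³ = 1`. [cite: ArtebaniDolgachev2009, §4 (`Φ₁₂` an invariant of the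
reflection group `Ḡ₂₁₆`)] -/
theorem phi12_bind₁_refl {w : K} (hw : w ^ 3 = 1) :
    bind₁ (𝛒[w] : Matrix (Fin 3) (Fin 3) K).toMvPolynomial (Φ₁₂ : MvPolynomial (Fin 3) K) = Φ₁₂ := by
  obtain ⟨h0, h1, h2⟩ := bind₁_refl_X w
  have hw' := C_pow_three_eq_one' hw
  have hS : (C w * X 0) ^ 3 + X 1 ^ 3 + X 2 ^ 3 = (X 0 ^ 3 + X 1 ^ 3 + X 2 ^ 3 : MvPolynomial (Fin 3) K) := by
    linear_combination (X 0 ^ 3 : MvPolynomial (Fin 3) K) * hw'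
  have hP : (C w * X 0 * X 1 * X 2) ^ 3 = ((X 0 * X 1 * X 2) ^ 3 : MvPolynomial (Fin 3) K) := by
    linear_combination ((X 0 * X 1 * X 2) ^ 3 : MvPolynomial (Fin 3) K) * hw'
  simp only [map_mul, map_add, map_pow, map_ofNat, h0, h1, h2]
  rw [hS, hP]

/-- **"`Φ'₁₂` … is not an invariant but a relative invariant (i.e. the elements of `Ḡ₂₁₆`
transform the polynomial to a constant multiple)"**: `Φ'₁₂ ∘ ρ_w = w · Φ'₁₂` for `w³ = 1` — the
reflection `ρ_w` multiplies `Φ'₁₂` by the character value `w` (`≠ 1` for `w = ω, ω²`), while it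
fixes `Φ₆, Φ₉, Φ₁₂`. [cite: ArtebaniDolgachev2009, §4 (`Φ'₁₂` a relative invariant)] -/
theorem phi12'_bind₁_refl {w : K} (hw : w ^ 3 = 1) :
    bind₁ (𝛒[w] : Matrix (Fin 3) (Fin 3) K).toMvPolynomial (Φ'₁₂ : MvPolynomial (Fin 3) K) =
      w • (Φ'₁₂ : MvPolynomial (Fin 3) K) := by
  obtain ⟨h0, h1, h2⟩ := bind₁_refl_X w
  have hw' := C_pow_three_eq_one' hw
  have hS : (C w * X 0) ^ 3 + X 1 ^ 3 + X 2 ^ 3 = (X 0 ^ 3 + X 1 ^ 3 + X 2 ^ 3 : MvPolynomial (Fin 3) K) := by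
    linear_combination (X 0 ^ 3 : MvPolynomial (Fin 3) K) * hw'
  have hP : (C w * X 0 * X 1 * X 2) ^ 3 = ((X 0 * X 1 * X 2) ^ 3 : MvPolynomial (Fin 3) K) := by
    linear_combination ((X 0 * X 1 * X 2) ^ 3 : MvPolynomial (Fin 3) K) * hw'
  simp only [map_mul, map_sub, map_add, map_pow, map_ofNat, h0, h1, h2, smul_eq_C_mul]
  rw [hS, hP]
  ring

end Invariants

end Literature.AlgebraicGeometry.PlaneCurves
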